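import Literature.Probability.RandomPlanarGeometry.SAWAdsorptionMarkedWalks
import Literature.Probability.RandomPlanarGeometry.SAWAdsorptionFreeEnergyFunction
import Literature.Probability.RandomPlanarGeometry.SAWAdsorptionUpperBound2065
import HarnessLib

/-!
# `a_c > 1` strictly: the adsorption transition of the half-plane self-avoiding walk on `ℤ²` lies above
# `√(1 + μ⁻²)` (Madras 2017, Theorem 2.4)

Topic `Literature/Probability/RandomPlanarGeometry` (continues `SAWAdsorptionMarkedWalks.lean` — the marked-edge bound
`Z⁺_n(a) ≤ a Σ_j (a²-1)^j Σ_{i≤2j} c_{n+i}` — and `SAWAdsorptionFreeEnergyFunction.lean`: `Zd.adsRate a = e^{κ(a)}`, the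
critical fugacity `Zd.adsCriticalFugacity = a_c = sup {a ≥ 0 : e^{κ(a)} = μ}` with `1 ≤ a_c ≤ 2.07 < μ`).

Madras 2017 (J. Phys. A 50 064003, arXiv:1606.08393), Theorem 2.4 (arXiv p. 6; proof §4.1 p. 11): «We have `𝓕^{W+}(β) = log μ_d` for every
`β ≤ ½ μ_d^{-2}`» («proving that `β_c^{W+} ≥ ½ μ_d^{-2}`»). With one mark per wall edge the same argument gives, for
`d = 2` and the vertex fugacity `a = e^β`:

* `Zd.adsZ_le_geom` — `Z⁺_n(a) ≤ a (3n+1) e^{6√(3n+1)} μ^{n+1} (2n+1) Σ_{j ≤ n} ((a²-1) μ²)^j` (with the tree's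
  `c_m ≤ (m+1) e^{6√(m+1)} b_{m+1} ≤ (m+1) e^{6√(m+1)} μ^{m+1}`);
* `Zd.adsRate_le_connectiveConstant_of_lt`, **`Zd.adsRate_eq_connectiveConstant_of_sq_lt : e^{κ(a)} = μ` whenever
  `0 ≤ a` and `a² < 1 + μ⁻²`** (the printed constant `e^{μ⁻²/2}` and ours `√(1+μ⁻²)` agree to first order `1 + μ⁻²/2`;
  the printed constant is the LARGER one, `e^{μ⁻²/2} > √(1+μ⁻²)` — we formalise the 0/1-mark variant, a corollary of
  Theorem 2.4, not an improvement: printed `a_c ≥ 1.0721…`, here `a_c ≥ 1.0674…`);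
* **`Zd.sqrt_le_adsCriticalFugacity : √(1 + μ(ℤ²)⁻²) ≤ a_c`**, **`Zd.one_lt_adsCriticalFugacity : 1 < a_c`** (the printed
  strict inequality, Hammersley–Torrie–Whittington 1982, «It is known that `1 < a_c^o < μ_d/μ_{d−1}`» as reported by
  Janse van Rensburg–Whittington 2013) and the numeral **`Zd.adsCriticalFugacity_gt : 1.066 < a_c`** (`μ(ℤ²) < 2.69`).

With `SAWAdsorptionUpperBound2065.lean`: **`Zd.adsCriticalFugacity_window : 1.066 < a_c ≤ 2.065`** (`< μ(ℤ²)`), both ends certified.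
Label: CONSOLIDATION (Madras 2017 Thm 2.4, variant constant; HTW82's `1 < a_c`). Pure standard axioms except the numeral
(inherits the `native_decide` certificates behind `μ(ℤ²) < 2.69`).
-/

noncomputable section

open Finset Filter Topology Literature.Probability.LatticeModels SimpleGraph
open scoped BigOperators

namespace Literature.Probability.RandomPlanarGeometry.SAW.Zd

/-! ### The free energy equals `log μ` below `√(1 + μ⁻²)` -/

/-- `c_m ≤ (m+1) e^{6√(m+1)} μ^{m+1}` (Hammersley–Welsh bound and `b_m ≤ μ^m`). [cite: MadrasSlade1993, §3.1, eq. (3.1.7) (p. 60)] -/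
private theorem count_le_poly_exp_pow (m : ℕ) :
    (count 2 m : ℝ) ≤ ((m : ℝ) + 1) * Real.exp (6 * Real.sqrt ((m : ℝ) + 1)) * connectiveConstant 2 ^ (m + 1) :=
  (count_le_mul_exp_mul_bridgeCount m).trans
    (mul_le_mul_of_nonneg_left (bridgeCount_le_pow (m + 1)) (by positivity))

/-- **`Z⁺_n(a) ≤ a (3n+1) e^{6√(3n+1)} μ^{n+1} (2n+1) Σ_{j ≤ n} ((a²-1) μ²)^j`** for `a ≥ 1`.
[cite: Madras2017, §4.1 (proof of Theorem 2.4: «Z^{WW+}_N(2β) ≤ A(μ+ε)^N/(1 − 2β(μ+ε)²)»)] -/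
theorem adsZ_le_geom (n : ℕ) {a : ℝ} (ha : 1 ≤ a) :
    adsZ n a ≤ a * ((3 * (n : ℝ) + 1) * Real.exp (6 * Real.sqrt (3 * (n : ℝ) + 1)) * connectiveConstant 2 ^ (n + 1) *
      (2 * (n : ℝ) + 1)) * ∑ j ∈ Finset.range (n + 1), ((a ^ 2 - 1) * connectiveConstant 2 ^ 2) ^ j := by
  set μ := connectiveConstant 2 with hμdef
  have hμ1 : 1 ≤ μ := one_le_connectiveConstant 2
  have hμ0 : 0 ≤ μ := zero_le_one.trans hμ1
  have h0 : 0 ≤ a := zero_le_one.trans ha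
  have hs : 0 ≤ a ^ 2 - 1 := by nlinarith
  set B := (3 * (n : ℝ) + 1) * Real.exp (6 * Real.sqrt (3 * (n : ℝ) + 1)) * μ ^ (n + 1) with hB
  have hB0 : 0 ≤ B := by positivity
  refine (adsZ_le_marked n ha).trans ?_
  rw [Finset.mul_sum, Finset.mul_sum]
  refine Finset.sum_le_sum fun j hj => ?_
  have hjn : j ≤ n := Nat.le_of_lt_succ (Finset.mem_range.1 hj)
  -- each `c_{n+i}`, `i ≤ 2j ≤ 2n`, is at most `B μ^{2j}`
  have hinner : ∑ i ∈ Finset.range (2 * j + 1), (count 2 (n + i) : ℝ) ≤ (2 * (n : ℝ) + 1) * (B * (μ ^ 2) ^ j) := by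
    have hterm : ∀ i ∈ Finset.range (2 * j + 1), (count 2 (n + i) : ℝ) ≤ B * (μ ^ 2) ^ j := by
      intro i hi
      have hi' : i ≤ 2 * j := Nat.le_of_lt_succ (Finset.mem_range.1 hi)
      refine (count_le_poly_exp_pow (n + i)).trans ?_
      have hi2 : (i : ℝ) ≤ 2 * j := by exact_mod_cast hi'
      have hj2 : (j : ℝ) ≤ n := by exact_mod_cast hjn
      have hcast : ((n + i : ℕ) : ℝ) + 1 ≤ 3 * (n : ℝ) + 1 := by push_cast; linarith
      have hpow : μ ^ (n + i + 1) ≤ μ ^ (n + 1) * (μ ^ 2) ^ j := by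
        rw [← pow_mul, ← pow_add]
        exact pow_le_pow_right₀ hμ1 (by omega)
      calc (((n + i : ℕ) : ℝ) + 1) * Real.exp (6 * Real.sqrt (((n + i : ℕ) : ℝ) + 1)) * μ ^ (n + i + 1)
          ≤ (3 * (n : ℝ) + 1) * Real.exp (6 * Real.sqrt (3 * (n : ℝ) + 1)) * (μ ^ (n + 1) * (μ ^ 2) ^ j) := by
            refine mul_le_mul (mul_le_mul hcast (Real.exp_le_exp.2 (mul_le_mul_of_nonneg_left
              (Real.sqrt_le_sqrt hcast) (by norm_num))) (Real.exp_nonneg _) (by positivity)) hpow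
              (pow_nonneg hμ0 _) (by positivity)
        _ = B * (μ ^ 2) ^ j := by rw [hB]; ring
    calc ∑ i ∈ Finset.range (2 * j + 1), (count 2 (n + i) : ℝ)
        ≤ ∑ _i ∈ Finset.range (2 * j + 1), B * (μ ^ 2) ^ j := Finset.sum_le_sum hterm
      _ = (2 * j + 1 : ℕ) * (B * (μ ^ 2) ^ j) := by rw [Finset.sum_const, Finset.card_range, nsmul_eq_mul]
      _ ≤ (2 * (n : ℝ) + 1) * (B * (μ ^ 2) ^ j) := by
          have hj2 : (j : ℝ) ≤ n := by exact_mod_cast hjn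
          refine mul_le_mul_of_nonneg_right ?_ (by positivity)
          push_cast; linarith
  calc a * ((a ^ 2 - 1) ^ j * ∑ i ∈ Finset.range (2 * j + 1), (count 2 (n + i) : ℝ))
      ≤ a * ((a ^ 2 - 1) ^ j * ((2 * (n : ℝ) + 1) * (B * (μ ^ 2) ^ j))) :=
        mul_le_mul_of_nonneg_left (mul_le_mul_of_nonneg_left hinner (pow_nonneg hs _)) h0
    _ = a * (B * (2 * (n : ℝ) + 1)) * ((a ^ 2 - 1) * μ ^ 2) ^ j := by rw [mul_pow]; ring

/-- `(xⁿ)^{1/n} = x` for `n ≥ 1`. [folklore] -/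
private theorem pow_rpow_one_div'' {x : ℝ} (hx : 0 ≤ x) {n : ℕ} (hn : n ≠ 0) :
    (x ^ n) ^ (1 / (n : ℝ)) = x := by
  rw [one_div, Real.pow_rpow_inv_natCast hx hn]

/-- `y² ≤ e^{4√y}` for `y > 0` (from `log √y ≤ √y - 1`). [folklore] -/
private theorem sq_le_exp_four_sqrt {y : ℝ} (hy : 0 < y) : y ^ 2 ≤ Real.exp (4 * Real.sqrt y) := by
  have hs : 0 < Real.sqrt y := Real.sqrt_pos.2 hy
  have hlog : Real.log y ≤ 2 * Real.sqrt y := by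
    have h := Real.log_le_sub_one_of_pos hs
    rw [Real.log_sqrt hy.le] at h
    linarith
  calc y ^ 2 = Real.exp (2 * Real.log y) := by rw [two_mul, Real.exp_add, Real.exp_log hy, sq]
    _ ≤ Real.exp (4 * Real.sqrt y) := Real.exp_le_exp.2 (by linarith)

/-- `√(3n+1)/n → 0`. [folklore] -/
private theorem tendsto_sqrt_three_mul_div : Tendsto (fun n : ℕ => Real.sqrt (3 * (n : ℝ) + 1) / n) atTop (𝓝 0) := by
  have hsqrt : Tendsto (fun n : ℕ => Real.sqrt (n : ℝ)) atTop atTop := by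
    have h := (tendsto_rpow_atTop (by norm_num : (0 : ℝ) < 1 / 2)).comp tendsto_natCast_atTop_atTop
    refine h.congr' (Eventually.of_forall fun n => ?_)
    simp [Function.comp, Real.sqrt_eq_rpow]
  have hup : Tendsto (fun n : ℕ => 2 / Real.sqrt (n : ℝ)) atTop (𝓝 0) := tendsto_const_nhds.div_atTop hsqrt
  refine tendsto_of_tendsto_of_tendsto_of_le_of_le' tendsto_const_nhds hup ?_ ?_
  · filter_upwards [eventually_ge_atTop 1] with n hn
    positivity
  · filter_upwards [eventually_ge_atTop 1] with n hn
    have hn1 : (1 : ℝ) ≤ n := by exact_mod_cast hn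
    have hs0 : 0 < Real.sqrt (n : ℝ) := Real.sqrt_pos.2 (by linarith)
    have hsq : Real.sqrt (n : ℝ) * Real.sqrt (n : ℝ) = n := Real.mul_self_sqrt (by linarith)
    have hle : Real.sqrt (3 * (n : ℝ) + 1) ≤ 2 * Real.sqrt (n : ℝ) := by
      rw [show (2 : ℝ) * Real.sqrt n = Real.sqrt (4 * n) by
        rw [Real.sqrt_mul' _ (by linarith), show Real.sqrt (4 : ℝ) = 2 by
          rw [show (4 : ℝ) = 2 ^ 2 by norm_num, Real.sqrt_sq (by norm_num)]]]
      exact Real.sqrt_le_sqrt (by linarith)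
    rw [div_le_div_iff₀ (by linarith) hs0]
    nlinarith

/-- **`e^{κ(a)} ≤ μ` when `a ≥ 1` and `(a² - 1) μ² < 1`**: the geometric series converges and the prefactor is
sub-exponential. [cite: Madras2017, Theorem 2.4 (proof, §4.1)] -/
theorem adsRate_le_connectiveConstant_of_lt {a : ℝ} (ha : 1 ≤ a) (h : (a ^ 2 - 1) * connectiveConstant 2 ^ 2 < 1) :
    adsRate a ≤ connectiveConstant 2 := by
  set μ := connectiveConstant 2 with hμdef
  set r := (a ^ 2 - 1) * μ ^ 2 with hr
  have hμ1 : 1 ≤ μ := one_le_connectiveConstant 2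
  have hμ0 : 0 < μ := zero_lt_one.trans_le hμ1
  have h0 : 0 ≤ a := zero_le_one.trans ha
  have hr0 : 0 ≤ r := mul_nonneg (by nlinarith) (pow_nonneg hμ0.le 2)
  -- the constant `C = a μ / (1 - r)` and `C' = max C 1`
  set C := a * μ / (1 - r) with hC
  have hC0 : 0 < C := div_pos (mul_pos (zero_lt_one.trans_le ha) hμ0) (by linarith)
  set C' := max C 1 with hC'
  have hC'1 : 1 ≤ C' := le_max_right _ _
  have hCC' : C ≤ C' := le_max_left _ _
  -- geometric sums are bounded by `1/(1-r)`
  have hgeom : ∀ n : ℕ, ∑ j ∈ Finset.range (n + 1), r ^ j ≤ 1 / (1 - r) := fun n => by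
    have hg := geom_sum_Ico_le_of_lt_one (m := 0) (n := n + 1) hr0 h
    rwa [pow_zero, ← Finset.range_eq_Ico] at hg
  -- `Z⁺_n(a) ≤ e^{t_n} μⁿ` with `t_n = log C' + 10 √(3n+1)`
  set t : ℕ → ℝ := fun n => Real.log C' + 10 * Real.sqrt (3 * (n : ℝ) + 1) with ht
  have hbound : ∀ n : ℕ, adsZ n a ≤ Real.exp (t n) * μ ^ n := by
    intro n
    have hy : (0 : ℝ) < 3 * (n : ℝ) + 1 := by positivity
    have hsq := sq_le_exp_four_sqrt hy
    have hE : 0 ≤ Real.exp (6 * Real.sqrt (3 * (n : ℝ) + 1)) := Real.exp_nonneg _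
    have h2n : (2 * (n : ℝ) + 1) ≤ 3 * (n : ℝ) + 1 := by have : (0:ℝ) ≤ n := Nat.cast_nonneg n; linarith
    calc adsZ n a ≤ a * ((3 * (n : ℝ) + 1) * Real.exp (6 * Real.sqrt (3 * (n : ℝ) + 1)) * μ ^ (n + 1) *
          (2 * (n : ℝ) + 1)) * ∑ j ∈ Finset.range (n + 1), r ^ j := adsZ_le_geom n ha
      _ ≤ a * ((3 * (n : ℝ) + 1) * Real.exp (6 * Real.sqrt (3 * (n : ℝ) + 1)) * μ ^ (n + 1) *
          (3 * (n : ℝ) + 1)) * (1 / (1 - r)) := by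
          refine mul_le_mul (mul_le_mul_of_nonneg_left (mul_le_mul_of_nonneg_left h2n (by positivity)) h0)
            (hgeom n) (Finset.sum_nonneg fun j _ => pow_nonneg hr0 j) (by positivity)
      _ = C * ((3 * (n : ℝ) + 1) ^ 2 * Real.exp (6 * Real.sqrt (3 * (n : ℝ) + 1))) * μ ^ n := by
          rw [hC, pow_succ]; field_simp
      _ ≤ C' * (Real.exp (4 * Real.sqrt (3 * (n : ℝ) + 1)) * Real.exp (6 * Real.sqrt (3 * (n : ℝ) + 1))) * μ ^ n := by
          gcongr
      _ = Real.exp (t n) * μ ^ n := by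
          have hexp : Real.exp (t n) = C' * (Real.exp (4 * Real.sqrt (3 * (n : ℝ) + 1)) *
              Real.exp (6 * Real.sqrt (3 * (n : ℝ) + 1))) := by
            rw [← Real.exp_add, ← Real.exp_log (zero_lt_one.trans_le hC'1), ← Real.exp_add]
            congr 1
            simp only [ht]
            ring
          rw [hexp]
  -- `t_n / n → 0`, so `(e^{t_n} μⁿ)^{1/n} = e^{t_n/n} μ → μ`
  have htn : Tendsto (fun n : ℕ => t n / n) atTop (𝓝 0) := by
    have h1 : Tendsto (fun n : ℕ => Real.log C' / (n : ℝ)) atTop (𝓝 0) :=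
      tendsto_const_nhds.div_atTop tendsto_natCast_atTop_atTop
    have h2 : Tendsto (fun n : ℕ => 10 * (Real.sqrt (3 * (n : ℝ) + 1) / n)) atTop (𝓝 0) := by
      simpa using tendsto_sqrt_three_mul_div.const_mul 10
    have := h1.add h2
    rw [add_zero] at this
    refine this.congr' (Eventually.of_forall fun n => ?_)
    simp only [ht]; ring
  have hup : Tendsto (fun n : ℕ => Real.exp (t n / n) * μ) atTop (𝓝 μ) := by
    have h := ((Real.continuous_exp.tendsto 0).comp htn).mul_const μ
    simpa using h
  refine le_of_tendsto_of_tendsto (tendsto_adsRate h0) hup ?_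
  filter_upwards [eventually_ge_atTop 1] with n hn
  have hnn : n ≠ 0 := by omega
  calc (adsZ n a) ^ (1 / (n : ℝ)) ≤ (Real.exp (t n) * μ ^ n) ^ (1 / (n : ℝ)) :=
        Real.rpow_le_rpow (adsZ_nonneg n h0) (hbound n) (by positivity)
    _ = Real.exp (t n / n) * μ := by
        rw [Real.mul_rpow (Real.exp_nonneg _) (pow_nonneg hμ0.le _), pow_rpow_one_div'' hμ0.le hnn,
          ← Real.exp_mul]
        congr 2
        ring

/-- **Madras 2017, Theorem 2.4 (binomial-marks constant): `e^{κ(a)} = μ` for every `0 ≤ a` with `a² < 1 + μ⁻²`.**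
[cite: Madras2017, Theorem 2.4] -/
theorem adsRate_eq_connectiveConstant_of_sq_lt {a : ℝ} (ha : 0 ≤ a)
    (h : a ^ 2 < 1 + (connectiveConstant 2)⁻¹ ^ 2) : adsRate a = connectiveConstant 2 := by
  rcases le_total a 1 with h1 | h1
  · exact adsRate_eq_connectiveConstant ha h1
  · have hμ0 : 0 < connectiveConstant 2 := connectiveConstant_pos 2
    refine le_antisymm (adsRate_le_connectiveConstant_of_lt h1 ?_) (connectiveConstant_le_adsRate ha)
    have hμ2 : 0 < connectiveConstant 2 ^ 2 := pow_pos hμ0 2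
    have : (a ^ 2 - 1) < (connectiveConstant 2)⁻¹ ^ 2 := by linarith
    calc (a ^ 2 - 1) * connectiveConstant 2 ^ 2 < (connectiveConstant 2)⁻¹ ^ 2 * connectiveConstant 2 ^ 2 :=
          mul_lt_mul_of_pos_right this hμ2
      _ = 1 := by rw [inv_pow, inv_mul_cancel₀ hμ2.ne']

/-- **`√(1 + μ(ℤ²)⁻²) ≤ a_c`** — an explicit lower bound on the critical fugacity.
[cite: Madras2017, Theorem 2.4 («proving that β_c^{W+} ≥ ½ μ_d^{-2}»)] -/
theorem sqrt_le_adsCriticalFugacity :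
    Real.sqrt (1 + (connectiveConstant 2)⁻¹ ^ 2) ≤ adsCriticalFugacity := by
  refine le_of_forall_lt_imp_le_of_dense fun b hb => ?_
  rcases lt_or_ge b 0 with hb0 | hb0
  · exact hb0.le.trans (zero_le_one.trans one_le_adsCriticalFugacity)
  · have hb2 : b ^ 2 < 1 + (connectiveConstant 2)⁻¹ ^ 2 := (Real.lt_sqrt hb0).1 hb
    exact le_csSup desorbedSet_bddAbove
      (show b ∈ {a : ℝ | 0 ≤ a ∧ adsRate a = connectiveConstant 2} from
        ⟨hb0, adsRate_eq_connectiveConstant_of_sq_lt hb0 hb2⟩)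

/-- **`1 < a_c` strictly** (Hammersley–Torrie–Whittington 1982; here with the explicit margin `√(1 + μ⁻²) - 1`).
[cite: Madras2017, Theorem 2.4] [cite: HammersleyTorrieWhittington1982, strict inequality 1 < a_c; as reported by JansevanRensburgWhittington2013 («It is known that 1 < a_c^o < μ_d/μ_{d−1}»)] -/
theorem one_lt_adsCriticalFugacity : 1 < adsCriticalFugacity := by
  refine lt_of_lt_of_le ((Real.lt_sqrt zero_le_one).2 ?_) sqrt_le_adsCriticalFugacity
  have := pow_pos (inv_pos.2 (connectiveConstant_pos 2)) 2
  rw [one_pow]; linarith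

/-- **`a_c > 1.066`** for the square lattice (from `μ(ℤ²) < 2.69`: `1 + 2.69⁻² = 1.13819… > 1.066²`).
[cite: Madras2017, Theorem 2.4] -/
theorem adsCriticalFugacity_gt : (1066 : ℝ) / 1000 < adsCriticalFugacity := by
  refine lt_of_lt_of_le ?_ sqrt_le_adsCriticalFugacity
  have hμ0 : 0 < connectiveConstant 2 := connectiveConstant_pos 2
  have hμ := connectiveConstant_two_lt_269
  have hinv : (100 : ℝ) / 269 < (connectiveConstant 2)⁻¹ := by
    rw [show (100 : ℝ) / 269 = (269 / 100)⁻¹ by norm_num]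
    exact (inv_lt_inv₀ (by norm_num) hμ0).2 hμ
  have hsq : ((100 : ℝ) / 269) ^ 2 < (connectiveConstant 2)⁻¹ ^ 2 := pow_lt_pow_left₀ hinv (by norm_num) two_ne_zero
  refine (Real.lt_sqrt (by norm_num)).2 ?_
  nlinarith

/-! ### The certified window for `a_c` -/

/-- `μ(ℤ²) < 2.69 ≤ e^{κ(2.065)}`: the walk is adsorbed at `a = 2.065` (`Zd.adsorbedAbove_2065`, length-`20` census).
[cite: BeatonGuttmannJensen2012Adsorption, §1 p. 2 (arXiv:1110.6695v1: «the existence of a critical value α_c»)] -/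
theorem connectiveConstant_lt_adsRate_2065 : connectiveConstant 2 < adsRate (413 / 200) :=
  connectiveConstant_two_lt_269.trans_le
    (le_adsRate_of_adsorbedAbove (by norm_num) (by norm_num) adsorbedAbove_2065)

/-- **`a_c ≤ 2.065`** (the last digit the length-`20` census supports, read on the critical fugacity).
[cite: BeatonGuttmannJensen2012Adsorption, §1 p. 2 (arXiv:1110.6695v1: «the existence of a critical value α_c»)] -/
theorem adsCriticalFugacity_le_2065 : adsCriticalFugacity ≤ 413 / 200 := by
  refine csSup_le desorbedSet_nonempty fun b hb => ?_
  by_contra hlt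
  have hmono := adsRate_mono (by norm_num : (0 : ℝ) ≤ 413 / 200) (not_le.1 hlt).le
  have h := connectiveConstant_lt_adsRate_2065
  rw [hb.2] at hmono
  linarith

/-- **The certified window `1.066 < a_c ≤ 2.065`** for the adsorption transition of the planar self-avoiding walk at an
impenetrable wall (vertex weights); in print `1 < a_c ≤ μ` and the estimate `a_c = 1.77564` (BGJ 2012).
[cite: BeatonGuttmannJensen2012Adsorption, §1 p. 2 (arXiv:1110.6695v1: «0 ≤ α_c ≤ log μ»)] [cite: Madras2017, Theorem 2.4] -/
theorem adsCriticalFugacity_window : (1066 : ℝ) / 1000 < adsCriticalFugacity ∧ adsCriticalFugacity ≤ 413 / 200 :=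
  ⟨adsCriticalFugacity_gt, adsCriticalFugacity_le_2065⟩

end Literature.Probability.RandomPlanarGeometry.SAW.Zd
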